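import Summits.QuantumFields.YangMills.Theorems.DiagonalMirrorRPRCubeSeamDefs
import Summits.QuantumFields.YangMills.Theorems.DiagonalMirrorRPRCubePairing
import Literature.MathematicalPhysics.QuantumFieldTheory.ConstructiveQFTWave0Proofs
import Literature.MathematicalPhysics.QuantumLattice.TorusWilsonGibbs
import HarnessLib

/-!
# Crux `WeakCouplingHypercubicLimitRP` (stmt-QuantumFields-27398), line `Sketch`, door C (`cube-surgery-decoupling`):
# THE SEAM INTERPOLATION IDENTITY — torus minus free cube is a finite sum of one-plaquette boundary influences

Helper file (`--supports stmt-QuantumFields-27398 --as helper`) of the crux lead `lead-27398-D1` g3 (docket director-ym g24, O4 WORD 37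
internal plan (p2) «door-C interpolation piece», typing prices idea-crit-9 g13 p-C1/p-C2/p-C3).  On the vocabulary of
✓ `…DiagonalMirrorRPRCubeSeamDefs` (`plaqCost`, `seamAction`, `seam`, `seamMeasure`, `seamInfluence`, `seamSum`):

* §1 the interpolating measures `seamMeasure ρ β S R A` (product Haar tilted by `−β (S_{Q_R} + seamAction A)`) are probability measures;
  `A = ∅` is the free-cube measure `cubeMeasure` (`seamMeasure_empty`, via `cubeMeasure_eq_tilted` — the free-cube twin of the tree's
  `wilsonMeasure_eq_tilted_pi`), `A = seam S R` is Wilson's torus measure (`seamMeasure_seam`, from `S_{Q_R} + seamAction (seam) = S_W`),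
  and re-inserting one plaquette is a one-plaquette Gibbs tilt (`seamMeasure_insert`, Mathlib `tilted_tilted`);
* §2 one Gibbs tilt moves an expectation by a normalised covariance (`integral_tilted_sub_integral`, pure measure theory), hence
  `E_{ν_{A ∪ {p}}}[Φ] − E_{ν_A}[Φ] = seamInfluence A p Φ` (`integral_seamMeasure_insert_sub`); telescoping along any enumeration `l` of the
  seam gives THE IDENTITY `∫ Φ dμ_torus − ∫ Φ dμ_cube = seamSum Φ l` (`integral_wilson_sub_integral_cube`) — exact, every finite volume,
  every `β`, every observable — and the bound `|∫ Φ dμ_torus − ∫ Φ dμ_cube| ≤ #seam · ε` from a uniform bound `ε` on the one-plaquette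
  influences over the intermediate boundary conditions (`abs_integral_wilson_sub_integral_cube_le`).

This is the finite-`k`, rate-carrying form demanded by p-C2: the companion `…PencilRigidityWeakCouplingHypercubicLimitRPOfSeamInfluenceDecay`
feeds it with the quantitative letter `SeamInfluenceDecay` to get `CubeDecoupling` (hence the D1′ socket via ✓p828702).

HONEST FRAMING: an exact finite-volume identity and its triangle inequality; nothing about the weak-coupling behaviour of Wilson's model is
proved (the decay of the influences IS the open letter, wall W-loc).  D1′, the crux ⟨27398⟩, its heart S6i and the summit are OPEN; the
Yang–Mills mass gap is NOT proved here or anywhere in the tree.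

References: Osterwalder–Seiler, Ann. Phys. 110 (1978) §2–4 (cluster expansion, boundary influences); Georgii, Gibbs Measures (2011) Def. 2.9;
Seiler, LNP 159 (1982) Ch. 2.
-/

set_option autoImplicit false

noncomputable section

open MeasureTheory Filter Topology
open Literature.MathematicalPhysics.QuantumLattice Literature.MathematicalPhysics.AQFT
  Literature.MathematicalPhysics.QuantumFieldTheory
open Summit.QuantumFields.YangMills.Cruxes.DiagonalMirrorRPR.SignTwistedDiagonalTrace (ReflectedFamily gramPairing famObs)

namespace Summit.QuantumFields.YangMills.Cruxes.DiagonalMirrorRPR.CubeSurgery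


/-! ## §1 Measurability and bounds of the plaquette costs; the interpolating measures are Gibbs tilts of product Haar -/

section Tilt

variable {G : Type} [Group G] [TopologicalSpace G] [IsTopologicalGroup G] [CompactSpace G] [MeasurableSpace G] [BorelSpace G]
  {N : ℕ} (ρ : G →* Matrix (Fin N) (Fin N) ℂ) {S : ℕ} [NeZero S]

omit [CompactSpace G] [NeZero S] in
/-- One plaquette's cost is measurable. [folklore] -/
theorem measurable_plaqCost (hρ : Continuous ρ) (p : Plaquette 4 S) : Measurable (plaqCost (G := G) ρ p) :=
  measurable_const.sub (WilsonRP.measurable_plaqRe ρ hρ p)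

omit [MeasurableSpace G] [BorelSpace G] [NeZero S] in
/-- One plaquette's cost is bounded by `2N`. [folklore] -/
theorem abs_plaqCost_le (hρ : Continuous ρ) (p : Plaquette 4 S) (U : GaugeConfig 4 S G) : |plaqCost ρ p U| ≤ 2 * N := by
  have h := WilsonRP.abs_plaqRe_le ρ hρ U p
  unfold plaqCost
  refine (abs_sub _ _).trans ?_
  rw [Nat.abs_cast]
  unfold WilsonRP.plaqRe at h
  linarith

omit [CompactSpace G] [NeZero S] in
/-- The action of a finite set of plaquettes is measurable. [folklore] -/
theorem measurable_seamAction (hρ : Continuous ρ) (A : Finset (Plaquette 4 S)) : Measurable (seamAction (G := G) ρ A) := by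
  unfold seamAction
  exact Finset.measurable_sum _ fun p _ => measurable_plaqCost ρ hρ p

omit [MeasurableSpace G] [BorelSpace G] [NeZero S] in
/-- The action of a finite set of plaquettes is bounded. [folklore] -/
theorem abs_seamAction_le (hρ : Continuous ρ) (A : Finset (Plaquette 4 S)) (U : GaugeConfig 4 S G) :
    |seamAction ρ A U| ≤ A.card * (2 * N) := by
  unfold seamAction
  refine (Finset.abs_sum_le_sum_abs _ _).trans ?_
  refine (Finset.sum_le_sum fun p _ => abs_plaqCost_le ρ hρ p U).trans ?_
  rw [Finset.sum_const, nsmul_eq_mul]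

omit [CompactSpace G] in
/-- The free-cube action is measurable. [folklore] -/
theorem measurable_cubeAction (hρ : Continuous ρ) (R : ℕ) : Measurable (cubeAction (G := G) ρ S R) := by
  classical
  unfold cubeAction
  refine Finset.measurable_sum _ fun p _ => ?_
  by_cases h : PlaqInCube S R p
  · simp only [if_pos h]
    exact measurable_plaqCost ρ hρ p
  · simp only [if_neg h]
    exact measurable_const

/-- The tilt exponent `−β (S_{Q_R} + seamAction A)` is measurable and bounded, hence its exponential is integrable against
product Haar. [folklore] -/
theorem integrable_exp_seamTilt (hρ : Continuous ρ) (β : ℝ) (R : ℕ) (A : Finset (Plaquette 4 S)) :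
    Integrable (fun U : GaugeConfig 4 S G => Real.exp (-β * (cubeAction ρ S R U + seamAction ρ A U)))
      (Measure.pi fun _ : Edge 4 S => haarProbability G) := by
  obtain ⟨B, hB⟩ := exists_abs_cubeAction_le (G := G) ρ hρ S R
  have hm : Measurable fun U : GaugeConfig 4 S G => Real.exp (-β * (cubeAction ρ S R U + seamAction ρ A U)) :=
    (((measurable_cubeAction ρ hρ R).add (measurable_seamAction ρ hρ A)).const_mul _).exp
  refine Integrable.of_bound hm.aestronglyMeasurable (Real.exp (|β| * (B + A.card * (2 * N)))) (ae_of_all _ fun U => ?_)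
  rw [Real.norm_eq_abs, Real.abs_exp, Real.exp_le_exp]
  have h1 : |cubeAction ρ S R U + seamAction ρ A U| ≤ B + A.card * (2 * N) :=
    (abs_add_le _ _).trans (add_le_add (hB U) (abs_seamAction_le ρ hρ A U))
  have h2 : |β * (cubeAction ρ S R U + seamAction ρ A U)| ≤ |β| * (B + A.card * (2 * N)) := by
    rw [abs_mul]; exact mul_le_mul_of_nonneg_left h1 (abs_nonneg _)
  have := (abs_le.1 h2).1
  linarith

/-- **The interpolating measures are probability measures.** [folklore] -/
theorem isProbabilityMeasure_seamMeasure (hρ : Continuous ρ) (β : ℝ) (R : ℕ) (A : Finset (Plaquette 4 S)) :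
    IsProbabilityMeasure (seamMeasure (G := G) ρ β S R A) := by
  haveI : NeZero (Measure.pi fun _ : Edge 4 S => haarProbability G) := ⟨IsProbabilityMeasure.ne_zero _⟩
  exact isProbabilityMeasure_tilted (integrable_exp_seamTilt ρ hρ β R A)

/-- **The free-cube measure is product Haar tilted by `−β S_{Q_R}`** (pattern of `wilsonMeasure_eq_tilted_pi`). [cite: Georgii2011, Def. 2.9] -/
theorem cubeMeasure_eq_tilted (hρ : Continuous ρ) (β : ℝ) (R : ℕ) :
    cubeMeasure (G := G) ρ β S R =
      (Measure.pi fun _ : Edge 4 S => haarProbability G).tilted fun U => -β * cubeAction ρ S R U := by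
  set π : Measure (GaugeConfig 4 S G) := Measure.pi fun _ : Edge 4 S => haarProbability G with hπ
  haveI : IsProbabilityMeasure π := by rw [hπ]; infer_instance
  have hwm : Measurable fun U : GaugeConfig 4 S G => Real.exp (-β * cubeAction ρ S R U) :=
    ((measurable_cubeAction ρ hρ R).const_mul _).exp
  obtain ⟨B, hB⟩ := exists_abs_cubeAction_le (G := G) ρ hρ S R
  have hint : Integrable (fun U : GaugeConfig 4 S G => Real.exp (-β * cubeAction ρ S R U)) π := by
    refine Integrable.of_bound hwm.aestronglyMeasurable (Real.exp (|β| * B)) (ae_of_all _ fun U => ?_)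
    rw [Real.norm_eq_abs, Real.abs_exp, Real.exp_le_exp]
    have h : |β * cubeAction ρ S R U| ≤ |β| * B := by
      rw [abs_mul]; exact mul_le_mul_of_nonneg_left (hB U) (abs_nonneg _)
    have := (abs_le.1 h).1
    linarith
  have hZ : cubeWeight (G := G) ρ β S R Set.univ = ENNReal.ofReal (∫ U, Real.exp (-β * cubeAction ρ S R U) ∂π) := by
    rw [ofReal_integral_eq_lintegral_ofReal hint (ae_of_all _ fun U => (Real.exp_pos _).le)]
    simp only [cubeWeight, withDensity_apply _ MeasurableSet.univ, Measure.restrict_univ, hπ]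
  have hZpos : 0 < ∫ U, Real.exp (-β * cubeAction ρ S R U) ∂π := integral_exp_pos hint
  have hdens : (fun U : GaugeConfig 4 S G => ENNReal.ofReal
      (Real.exp (-β * cubeAction ρ S R U) / ∫ V, Real.exp (-β * cubeAction ρ S R V) ∂π)) =
      (ENNReal.ofReal (∫ V, Real.exp (-β * cubeAction ρ S R V) ∂π))⁻¹ •
        fun U => ENNReal.ofReal (Real.exp (-β * cubeAction ρ S R U)) := by
    funext U
    simp only [Pi.smul_apply, smul_eq_mul]
    rw [div_eq_mul_inv, ENNReal.ofReal_mul (Real.exp_pos _).le, ENNReal.ofReal_inv_of_pos hZpos, mul_comm]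
  rw [Measure.tilted, hdens, withDensity_smul' _ _ (ENNReal.inv_ne_top.2 (ENNReal.ofReal_pos.2 hZpos).ne'), cubeMeasure, hZ,
    cubeWeight]

/-- Boundary condition `∅` is the free cube. [folklore] -/
theorem seamMeasure_empty (hρ : Continuous ρ) (β : ℝ) (R : ℕ) :
    seamMeasure (G := G) ρ β S R ∅ = cubeMeasure ρ β S R := by
  rw [cubeMeasure_eq_tilted ρ hρ β R]
  unfold seamMeasure
  congr 1
  funext U
  simp [seamAction]

omit [TopologicalSpace G] [IsTopologicalGroup G] [CompactSpace G] [MeasurableSpace G] [BorelSpace G] in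
/-- The free-cube action plus the seam action is the Wilson action of the torus. [folklore] -/
theorem cubeAction_add_seamAction_seam (R : ℕ) (U : GaugeConfig 4 S G) :
    cubeAction ρ S R U + seamAction ρ (seam S R) U = wilsonAction ρ U := by
  classical
  unfold cubeAction seamAction seam wilsonAction plaqCost
  rw [Finset.sum_filter, ← Finset.sum_add_distrib]
  refine Finset.sum_congr rfl fun p _ => ?_
  by_cases h : PlaqInCube S R p
  · rw [if_pos h, if_neg (not_not.2 h), add_zero]
  · rw [if_neg h, if_pos h, zero_add]

/-- Boundary condition `seam S R` (everything re-inserted) is Wilson's torus measure. [cite: Georgii2011, Def. 2.9] -/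
theorem seamMeasure_seam [SecondCountableTopology G] (hρ : Continuous ρ) (β : ℝ) (R : ℕ) :
    seamMeasure (G := G) ρ β S R (seam S R) = wilsonMeasure ρ β := by
  rw [wilsonMeasure_eq_tilted_pi ρ hρ β]
  unfold seamMeasure
  congr 1
  funext U
  rw [cubeAction_add_seamAction_seam]

/-- **Re-inserting one plaquette is a one-plaquette Gibbs tilt**: `ν_{A ∪ {p}} = ν_A.tilted (−β plaqCost p)` for `p ∉ A`.
[cite: Georgii2011, Def. 2.9] -/
theorem seamMeasure_insert (hρ : Continuous ρ) (β : ℝ) (R : ℕ) {A : Finset (Plaquette 4 S)} {p : Plaquette 4 S} (hp : p ∉ A) :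
    seamMeasure (G := G) ρ β S R (insert p A) = (seamMeasure ρ β S R A).tilted fun U => -β * plaqCost ρ p U := by
  unfold seamMeasure
  rw [tilted_tilted (integrable_exp_seamTilt ρ hρ β R A)]
  congr 1
  funext U
  simp only [Pi.add_apply, seamAction, Finset.sum_insert hp]
  ring

end Tilt

/-! ## §2 One Gibbs tilt moves an expectation by a normalised covariance; telescoping over the seam -/

section Telescope

/-- **One-step identity**: for a probability measure `μ` and bounded measurable `g, Φ`,
`∫ Φ d(μ.tilted g) − ∫ Φ dμ = (∫ Φ e^g dμ − ∫ Φ dμ · ∫ e^g dμ) / ∫ e^g dμ`. [cite: Georgii2011, Def. 2.9] -/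
theorem integral_tilted_sub_integral {Ω : Type*} [MeasurableSpace Ω] (μ : Measure Ω) [IsProbabilityMeasure μ]
    {g Φ : Ω → ℝ} (hg : Measurable g) (hgb : ∃ B : ℝ, ∀ x, |g x| ≤ B) :
    ∫ x, Φ x ∂(μ.tilted g) - ∫ x, Φ x ∂μ =
      ((∫ x, Φ x * Real.exp (g x) ∂μ) - (∫ x, Φ x ∂μ) * (∫ x, Real.exp (g x) ∂μ)) / ∫ x, Real.exp (g x) ∂μ := by
  obtain ⟨B, hB⟩ := hgb
  have hint : Integrable (fun x => Real.exp (g x)) μ := by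
    refine Integrable.of_bound hg.exp.aestronglyMeasurable (Real.exp B) (ae_of_all _ fun x => ?_)
    rw [Real.norm_eq_abs, Real.abs_exp, Real.exp_le_exp]
    exact (abs_le.1 (hB x)).2
  have hZ : 0 < ∫ x, Real.exp (g x) ∂μ := integral_exp_pos hint
  rw [integral_tilted]
  have h1 : ∫ x, (Real.exp (g x) / ∫ y, Real.exp (g y) ∂μ) • Φ x ∂μ =
      (∫ x, Φ x * Real.exp (g x) ∂μ) / ∫ y, Real.exp (g y) ∂μ := by
    rw [← integral_div]
    refine integral_congr_ae (ae_of_all _ fun x => ?_)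
    simp only [smul_eq_mul]
    ring
  rw [h1]
  field_simp

variable {G : Type} [Group G] [TopologicalSpace G] [IsTopologicalGroup G] [CompactSpace G] [MeasurableSpace G] [BorelSpace G]
  {N : ℕ} (ρ : G →* Matrix (Fin N) (Fin N) ℂ) {S : ℕ} [NeZero S]

/-- **The one-plaquette influence IS the change of expectation**: `E_{ν_{A ∪ {p}}}[Φ] − E_{ν_A}[Φ] = seamInfluence A p Φ`
for `p ∉ A`. [cite: Georgii2011, Def. 2.9] -/
theorem integral_seamMeasure_insert_sub (hρ : Continuous ρ) (β : ℝ) (R : ℕ) {A : Finset (Plaquette 4 S)}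
    {p : Plaquette 4 S} (hp : p ∉ A) (Φ : GaugeConfig 4 S G → ℝ) :
    ∫ U, Φ U ∂(seamMeasure ρ β S R (insert p A)) - ∫ U, Φ U ∂(seamMeasure ρ β S R A) = seamInfluence ρ β S R A p Φ := by
  haveI := isProbabilityMeasure_seamMeasure (G := G) ρ hρ β R A
  rw [seamMeasure_insert ρ hρ β R hp]
  unfold seamInfluence
  exact integral_tilted_sub_integral _ ((measurable_plaqCost ρ hρ p).const_mul _)
    ⟨|β| * (2 * N), fun U => by
      rw [abs_mul, abs_neg]; exact mul_le_mul_of_nonneg_left (abs_plaqCost_le ρ hρ p U) (abs_nonneg _)⟩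

/-- **Telescoping**: along any list of distinct plaquettes, the expectation under the boundary condition «all of them» minus the
free-cube expectation is the sum of the one-plaquette influences. [cite: OsterwalderSeiler1978, §3] -/
theorem integral_sub_integral_eq_seamSum (hρ : Continuous ρ) (β : ℝ) (R : ℕ) (Φ : GaugeConfig 4 S G → ℝ) :
    ∀ l : List (Plaquette 4 S), l.Nodup →
      ∫ U, Φ U ∂(seamMeasure ρ β S R l.toFinset) - ∫ U, Φ U ∂(seamMeasure ρ β S R ∅) = seamSum ρ β S R Φ l
  | [], _ => by simp [seamSum]
  | (p :: l), h => by
      rw [List.nodup_cons] at h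
      have hp : p ∉ l.toFinset := by rw [List.mem_toFinset]; exact h.1
      have ih := integral_sub_integral_eq_seamSum hρ β R Φ l h.2
      rw [List.toFinset_cons, seamSum, ← ih, ← integral_seamMeasure_insert_sub ρ hρ β R hp Φ]
      ring

/-- **The seam interpolation identity (torus minus free cube).**  For every enumeration `l` of the seam of the free cube `Q_R` in the
torus of side `S` and every observable `Φ`:
`∫ Φ dμ_torus − ∫ Φ dμ_cube = seamSum Φ l` — a finite sum of one-plaquette boundary influences (exact, finite volume, every `β`).
[cite: OsterwalderSeiler1978, §3] -/
theorem integral_wilson_sub_integral_cube [SecondCountableTopology G] (hρ : Continuous ρ) (β : ℝ) (R : ℕ)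
    (Φ : GaugeConfig 4 S G → ℝ) (l : List (Plaquette 4 S)) (hl : l.Nodup) (hseam : l.toFinset = seam S R) :
    ∫ U, Φ U ∂(wilsonMeasure ρ β) - ∫ U, Φ U ∂(cubeMeasure ρ β S R) = seamSum ρ β S R Φ l := by
  rw [← seamMeasure_seam ρ hρ β R, ← hseam, ← seamMeasure_empty ρ hρ β R]
  exact integral_sub_integral_eq_seamSum ρ hρ β R Φ l hl

/-- The seam has an enumeration (its `toList`). [folklore] -/
theorem exists_seam_enumeration (R : ℕ) :
    ∃ l : List (Plaquette 4 S), l.Nodup ∧ l.toFinset = seam S R ∧ l.length = (seam S R).card :=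
  ⟨(seam S R).toList, Finset.nodup_toList _, Finset.toList_toFinset _, Finset.length_toList _⟩

/-- **Bounding the telescoping sum**: a uniform bound `ε` on the one-plaquette influences over the boundary conditions met along `l`
gives `|seamSum Φ l| ≤ l.length · ε`. [folklore] -/
theorem abs_seamSum_le (β : ℝ) (R : ℕ) (Φ : GaugeConfig 4 S G → ℝ) (T : Finset (Plaquette 4 S)) {ε : ℝ}
    (hε : ∀ (A : Finset (Plaquette 4 S)) (p : Plaquette 4 S), A ⊆ T → p ∈ T → p ∉ A →
      |seamInfluence ρ β S R A p Φ| ≤ ε) :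
    ∀ l : List (Plaquette 4 S), l.Nodup → l.toFinset ⊆ T → |seamSum ρ β S R Φ l| ≤ l.length * ε
  | [], _, _ => by simp [seamSum]
  | (p :: l), h, hT => by
      rw [List.nodup_cons] at h
      rw [List.toFinset_cons] at hT
      have hp : p ∉ l.toFinset := by rw [List.mem_toFinset]; exact h.1
      have hpT : p ∈ T := hT (Finset.mem_insert_self _ _)
      have hlT : l.toFinset ⊆ T := fun q hq => hT (Finset.mem_insert_of_mem hq)
      have ih := abs_seamSum_le β R Φ T hε l h.2 hlT
      have h1 := hε l.toFinset p hlT hpT hp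
      simp only [seamSum, List.length_cons, Nat.cast_succ]
      calc |seamInfluence ρ β S R l.toFinset p Φ + seamSum ρ β S R Φ l|
          ≤ |seamInfluence ρ β S R l.toFinset p Φ| + |seamSum ρ β S R Φ l| := abs_add_le _ _
        _ ≤ ε + l.length * ε := add_le_add h1 ih
        _ = (l.length + 1) * ε := by ring

/-- **Torus minus free cube, bounded by the number of seam plaquettes times a uniform influence bound.**
[cite: OsterwalderSeiler1978, §3] -/
theorem abs_integral_wilson_sub_integral_cube_le [SecondCountableTopology G] (hρ : Continuous ρ) (β : ℝ) (R : ℕ)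
    (Φ : GaugeConfig 4 S G → ℝ) {ε : ℝ}
    (hε : ∀ (A : Finset (Plaquette 4 S)) (p : Plaquette 4 S), A ⊆ seam S R → p ∈ seam S R → p ∉ A →
      |seamInfluence ρ β S R A p Φ| ≤ ε) :
    |∫ U, Φ U ∂(wilsonMeasure ρ β) - ∫ U, Φ U ∂(cubeMeasure ρ β S R)| ≤ (seam S R).card * ε := by
  obtain ⟨l, hl, hls, hlen⟩ := exists_seam_enumeration (S := S) R
  rw [integral_wilson_sub_integral_cube ρ hρ β R Φ l hl hls, ← hlen]
  exact abs_seamSum_le ρ β R Φ (seam S R) hε l hl hls.le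

end Telescope

end Summit.QuantumFields.YangMills.Cruxes.DiagonalMirrorRPR.CubeSurgery

end
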